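import Summits.CriticalPhenomena.SAWScalingLimit.Theorems.SAWLoopFugacityFlowIsingBoundaryRatioForgettingDefs
import Literature.Probability.LatticeModels.RandomClusterProofs
import Literature.Probability.LatticeModels.IsingTransport
import HarnessLib

/-!
# Line `fk-anchor-transfer`, heart glue (α): Edwards–Sokal for a finite volume of a graph on `Site 2`
(crux `SAWLoopFugacityFlow.IsingBoundaryRatio`, stmt-CriticalPhenomena-10650; skeleton
`Summits/CriticalPhenomena/SAWScalingLimit/Cruxes/IsingBoundaryRatio/Lines/fk_anchor_transfer.lean`, rev 5)

The repaired heart `ArmOriginForgettingAt'` speaks about the free critical Ising two-point function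
`freeTwoPoint G Λ x y = ⟨σ_xσ_y⟩^free_{(G,Λ); β_c, 0}` of an arbitrary finite volume `Λ : Finset (Site 2)` of
a locally finite graph `G` on `Site 2` (interaction edges `edgesIn G Λ`). This file puts it in percolation
language: it is the connection probability `φ⁰_{H}[x ↔ y]` of the FREE FK–Ising (random-cluster, `q = 2`,
`p = 1 - e^{-2β_c}`) measure of the finite graph `H = G.comap Subtype.val` on the vertex type `↥Λ` — the graph
the line's RSW stub `RoughHalfAnnulusRSW` is stated for. Proof: transport of free expectations along the
embedding `↥Λ ↪ Site 2` (`isingTwoPoint_free_map`), then the tree's finite-graph Edwards–Sokal identity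
`edwardsSokal_twoPoint_holds` (Grimmett 2006, Thm 1.16). The special case `(G, Λ) = (Ω_δ, meshDomainFinset)` is
`stub_T_eq_fkConn` (`…EdwardsSokal.lean`).
-/

noncomputable section

open scoped Classical
open MeasureTheory
open Literature.Probability.LatticeModels

namespace Summit.CriticalPhenomena.SAWScalingLimit.Theorems.IsingBoundaryRatio

/-- **Edwards–Sokal for a finite volume** (heart glue α of line `fk-anchor-transfer`, rev 5): for a locally
finite graph `G` on `Site 2`, a finite volume `Λ` and `x, y ∈ Λ`,
`freeTwoPoint G Λ x y = φ^{free}_{G.comap val, 1 - e^{-2β_c}, 2}[x ↔ y]` on the vertex type `↥Λ`. -/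
theorem stub_freeTwoPoint_eq_fkConn :
    ∀ (G : SimpleGraph (Site 2)) [G.LocallyFinite] (Λ : Finset (Site 2)) (x y : Site 2)
      (hx : x ∈ Λ) (hy : y ∈ Λ),
      freeTwoPoint G Λ x y =
        (rcMeasure (G.comap (Subtype.val : ↥Λ → Site 2)) (1 - Real.exp (-2 * criticalBetaTwo)) 2 ∅).real
          (Literature.Probability.Percolation.openConn (⟨x, hx⟩ : ↥Λ) ⟨y, hy⟩) := by
  intro G _ Λ x y hx hy
  have hES := edwardsSokal_twoPoint_holds (G.comap (Subtype.val : ↥Λ → Site 2)) criticalBetaTwo_pos.le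
    (⟨x, hx⟩ : ↥Λ) ⟨y, hy⟩
  rw [← hES]
  have hmap := isingTwoPoint_free_map (G := G.comap (Subtype.val : ↥Λ → Site 2)) (G' := G)
    (Function.Embedding.subtype (· ∈ Λ)) (Λ := (Finset.univ : Finset ↥Λ))
    (fun a _ b _ => by simp [SimpleGraph.comap_adj]) criticalBetaTwo 0 (⟨x, hx⟩ : ↥Λ) ⟨y, hy⟩
  have huniv : (Finset.univ : Finset ↥Λ).map (Function.Embedding.subtype (· ∈ Λ)) = Λ := by
    rw [Finset.univ_eq_attach, Finset.attach_map_val]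
  rw [huniv] at hmap
  simpa [freeTwoPoint] using hmap

end Summit.CriticalPhenomena.SAWScalingLimit.Theorems.IsingBoundaryRatio

end
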